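import Mathlib.Analysis.InnerProductSpace.GramSchmidtOrtho
import Mathlib.Analysis.InnerProductSpace.PiL2
import Mathlib.LinearAlgebra.Matrix.Permanent
import Mathlib.LinearAlgebra.Matrix.ConjTranspose
import HarnessLib

/-!
# Gram–Schmidt on a nearly orthogonal family: the triangular factor is close to the identity

Topic `Analysis/Matrix`. Written for the discharge of Aaronson–Arkhipov's Main Theorem
(S. Aaronson, A. Arkhipov, *The computational complexity of linear optics*, Theory of Computing 9
(2013) 143–252, Thm. 1.3; named fact
`Literature.Computability.QuantumComplexity.gpeSolvableInFBPPRel_NPRel_of_approxBosonSamplingOracle`),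
whose finite-precision hiding step orthonormalises the columns of a tall random matrix `B`
(i.i.d. entries, so `Bᴴ B ≈ N · 1`) by Gram–Schmidt and feeds the column-orthonormal result `U`
to the BosonSampling oracle. Everything here is proved, Mathlib only (complex inner product
spaces; `InnerProductSpace.gramSchmidt`).

## Results

For a family `b₀, …, bₙ₋₁` in a complex inner product space with Gram–Schmidt vectors `b*ₖ`
(Mathlib's `gramSchmidt ℂ`):

* `gsT`, `gramSchmidt_eq_sum_gsT` — the inverse triangular factor: `b*ₖ = ∑ⱼ T k j • bⱼ` with
  `T k k = 1`, `T k j = 0` for `j > k` (`gsT_self`, `gsT_eq_zero_of_lt`), defined by the recursion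
  `T k j = δⱼₖ - ∑_{i<k} c i k · T i j`, `c i k = ⟪b*ᵢ, bₖ⟫/‖b*ᵢ‖²` (`gsCoeff`).
* **`norm_gsT_le`** — if `|⟪bᵢ, bⱼ⟫ - N δᵢⱼ| ≤ t N` (`NearOrthogonal`) with `N > 0`,
  `0 ≤ t ≤ 1/4` and `8 t n ≤ 1`, then `|T k j| ≤ 8 t` for all `j < k`; along the way
  `|⟪b*ᵢ, bₖ⟫| ≤ 2 t N` (`norm_inner_gramSchmidt_le`), `|c i k| ≤ 4 t` (`norm_gsCoeff_le`) and
  `N/2 ≤ ‖b*ₖ‖² ≤ (1 + t) N` (`half_le_norm_gramSchmidt_sq'`, `norm_gramSchmidt_sq_le`), so no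
  Gram–Schmidt vector vanishes. Strong induction on `k`; the constants are not optimised.
* Matrices (`B : Matrix (Fin m) (Fin n) ℂ`, columns `colVec B k ∈ ℂᵐ`, Gram matrix `Bᴴ B`,
  `inner_colVec`): `gsMatrix B = B * tMatrix B` (`gsMatrix_eq_mul`), the column-normalised
  `gsUnit B = gsMatrix B * diag(‖b*ₖ‖⁻¹)`, `(gsUnit B)ᴴ * gsUnit B = 1` when no `b*ₖ` vanishes
  (`conjTranspose_mul_gsUnit`), and for every row selection `S : Fin n → Fin m`
  `Per((gsUnit B)_S) = Per(B_S · tMatrix B) · ∏ₖ ‖b*ₖ‖⁻¹` (`permanent_submatrix_gsUnit`,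
  `permanent_mul_diagonal`). Under near-orthogonality of the columns: `tMatrix B - 1` is strictly
  upper triangular with entries `≤ 8 t` (`norm_tMatrix_sub_one_le`,
  `tMatrix_sub_one_apply_eq_zero`), `N/2 ≤ ‖b*ₖ‖² ≤ (1+t) N`
  (`norm_gramSchmidt_colVec_sq_bounds`) and `gsUnit B` is column-orthonormal
  (`conjTranspose_mul_gsUnit_of_nearOrthogonal`).

Combined with `Literature/LinearAlgebra/Matrix/PermanentColumnPerturbation.lean`
(`|Per(Y(1+E)) - Per(Y)| ≤ Z_{8t}(Y)` for such `E = tMatrix B - 1`), this controls the permanent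
of the planted block of `gsUnit B` by that of the planted block of `B`.

## Design

* `ℂ` rather than a general `RCLike 𝕜`: the consumer is complex, and this keeps one coercion
  `ℝ → ℂ` in the statements (Mathlib's generic lemmas produce `RCLike.ofReal`, definitionally but
  not syntactically `Complex.ofReal`; the few bridges go through `norm_sq_eq_re_inner` and
  `inner_self_eq_norm_sq_to_K` by definitional unfolding).
* `T` is introduced by its recursion (not as a matrix inverse), which gives `b*ₖ = ∑ T k j bⱼ`,
  triangularity and the entry bounds by three inductions of the same shape.

## References

* Å. Björck, *Numerical Methods for Least Squares Problems*, SIAM 1996, §2.4 (Gram–Schmidt and the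
  QR factorisation; sensitivity of the triangular factor). (Standard; the elementary bounds here
  are proved directly.)
* S. Aaronson, A. Arkhipov, *The computational complexity of linear optics*, Theory of Computing 9
  (2013) 143–252, §5.2 (Gram–Schmidt orthogonalisation of a Gaussian matrix in the hiding lemma).
-/

namespace Literature.Analysis.Matrix

open Finset InnerProductSpace
open scoped _root_.Matrix ComplexConjugate

section General

variable {E : Type*} [NormedAddCommGroup E] [InnerProductSpace ℂ E] {n : ℕ}

local notation "⟪" x ", " y "⟫" => inner ℂ x y

/-- The Gram–Schmidt projection coefficient `c i k = ⟪b*ᵢ, bₖ⟫ / ‖b*ᵢ‖²` (so that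
`bₖ = b*ₖ + ∑_{i<k} c i k • b*ᵢ`, Mathlib's `gramSchmidt_def''`). [folklore] -/
noncomputable def gsCoeff (f : Fin n → E) (i k : Fin n) : ℂ :=
  ⟪gramSchmidt ℂ f i, f k⟫ / (‖gramSchmidt ℂ f i‖ : ℂ) ^ 2

/-- **The inverse triangular factor**: the coefficients `T k j` with `b*ₖ = ∑ⱼ T k j • bⱼ`,
defined by the recursion `T k j = δⱼₖ - ∑_{i<k} c i k · T i j` read off
`b*ₖ = bₖ - ∑_{i<k} c i k • b*ᵢ`. [folklore] -/
noncomputable def gsT (f : Fin n → E) (k : Fin n) : Fin n → ℂ :=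
  fun j => (if j = k then 1 else 0) - ∑ i : Iio k, gsCoeff f i k * gsT f i j
termination_by k
decreasing_by exact Fin.lt_def.1 (mem_Iio.1 i.2)

/-- Unfolding the recursion of `gsT` (with `∑ i ∈ Iio k`). [folklore] -/
theorem gsT_def (f : Fin n → E) (k j : Fin n) :
    gsT f k j = (if j = k then 1 else 0) - ∑ i ∈ Iio k, gsCoeff f i k * gsT f i j := by
  rw [gsT, ← sum_attach (Iio k), attach_eq_univ]

/-- **`b*ₖ = ∑ⱼ T k j • bⱼ`.** [folklore] -/
theorem gramSchmidt_eq_sum_gsT (f : Fin n → E) (k : Fin n) :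
    gramSchmidt ℂ f k = ∑ j, gsT f k j • f j := by
  induction k using WellFoundedLT.induction with
  | ind k ih =>
    have hdef : gramSchmidt ℂ f k = f k - ∑ i ∈ Iio k, gsCoeff f i k • gramSchmidt ℂ f i := by
      rw [eq_sub_iff_add_eq]
      exact (gramSchmidt_def'' ℂ f k).symm
    rw [hdef]
    have hT : ∀ j, gsT f k j • f j =
        (if j = k then f j else 0) - ∑ i ∈ Iio k, gsCoeff f i k • (gsT f i j • f j) := by
      intro j
      rw [gsT_def, sub_smul, Finset.sum_smul, ite_smul, one_smul, zero_smul]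
      simp_rw [mul_smul]
    simp_rw [hT]
    rw [Finset.sum_sub_distrib, Finset.sum_ite_eq' univ k, if_pos (mem_univ k), Finset.sum_comm]
    congr 1
    refine Finset.sum_congr rfl fun i hi => ?_
    rw [ih i (mem_Iio.1 hi), Finset.smul_sum]

/-- `T k j = 0` for `j > k` (upper triangularity, in the convention `b*ₖ = ∑ⱼ T k j • bⱼ`).
[folklore] -/
theorem gsT_eq_zero_of_lt (f : Fin n → E) {k j : Fin n} (h : k < j) : gsT f k j = 0 := by
  induction k using WellFoundedLT.induction with
  | ind k ih =>
    rw [gsT_def, if_neg h.ne', zero_sub, neg_eq_zero]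
    exact Finset.sum_eq_zero fun i hi => by
      rw [ih i (mem_Iio.1 hi) ((mem_Iio.1 hi).trans h), mul_zero]

/-- `T k k = 1` (unit diagonal). [folklore] -/
theorem gsT_self (f : Fin n → E) (k : Fin n) : gsT f k k = 1 := by
  rw [gsT_def, if_pos rfl, sub_eq_self]
  exact Finset.sum_eq_zero fun i hi => by
    rw [gsT_eq_zero_of_lt f (mem_Iio.1 hi), mul_zero]

/-- `⟪b*ᵢ, bₖ⟫ = ∑ⱼ conj (T i j) ⟪bⱼ, bₖ⟫`. [folklore] -/
theorem inner_gramSchmidt_eq_sum (f : Fin n → E) (i k : Fin n) :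
    ⟪gramSchmidt ℂ f i, f k⟫ = ∑ j, (starRingEnd ℂ) (gsT f i j) * ⟪f j, f k⟫ := by
  rw [gramSchmidt_eq_sum_gsT, sum_inner]
  simp_rw [inner_smul_left]

/-- `⟪b*ᵢ, b*ᵢ⟫ = ⟪b*ᵢ, bᵢ⟫` (the projections subtracted from `bᵢ` are orthogonal to `b*ᵢ`), so
`‖b*ᵢ‖² = re ⟪b*ᵢ, bᵢ⟫`. [folklore] -/
theorem inner_gramSchmidt_self (f : Fin n → E) (i : Fin n) :
    ⟪gramSchmidt ℂ f i, gramSchmidt ℂ f i⟫ = ⟪gramSchmidt ℂ f i, f i⟫ := by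
  conv_rhs => rw [gramSchmidt_def'' ℂ f i]
  rw [inner_add_right, inner_sum]
  suffices h : ∑ l ∈ Iio i, ⟪gramSchmidt ℂ f i, (⟪gramSchmidt ℂ f l, f i⟫ /
      (RCLike.ofReal ‖gramSchmidt ℂ f l‖ : ℂ) ^ 2) • gramSchmidt ℂ f l⟫ = 0 by
    rw [h, add_zero]
  exact Finset.sum_eq_zero fun l hl => by
    rw [inner_smul_right, gramSchmidt_orthogonal ℂ f (mem_Iio.1 hl).ne', mul_zero]

/-- `‖b*ᵢ‖² = re ⟪b*ᵢ, bᵢ⟫`. [folklore] -/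
theorem norm_gramSchmidt_sq_eq_re (f : Fin n → E) (i : Fin n) :
    ‖gramSchmidt ℂ f i‖ ^ 2 = (⟪gramSchmidt ℂ f i, f i⟫).re := by
  rw [← inner_gramSchmidt_self, norm_sq_eq_re_inner (𝕜 := ℂ)]
  rfl

/-! ### Perturbation bounds for a nearly orthogonal family -/

variable {f : Fin n → E} {N t : ℝ}

/-- The near-orthogonality hypothesis: `|⟪bᵢ, bⱼ⟫ - N δᵢⱼ| ≤ t N`. [folklore] -/
def NearOrthogonal (f : Fin n → E) (N t : ℝ) : Prop :=
  ∀ i j, ‖⟪f i, f j⟫ - (if i = j then (N : ℂ) else 0)‖ ≤ t * N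

/-- Row sums of `|T|`: if `|T i j| ≤ 8t` for `j < i` then `∑ⱼ |T i j| ≤ 1 + 8 t n`. [folklore] -/
theorem sum_norm_gsT_le {i : Fin n} (hrow : ∀ j, j < i → ‖gsT f i j‖ ≤ 8 * t) (ht0 : 0 ≤ t) :
    ∑ j, ‖gsT f i j‖ ≤ 1 + 8 * t * n := by
  rw [← Finset.add_sum_erase _ _ (mem_univ i), gsT_self, norm_one]
  suffices h : ∑ j ∈ univ.erase i, ‖gsT f i j‖ ≤ 8 * t * n by linarith
  have hterm : ∀ j ∈ univ.erase i, ‖gsT f i j‖ ≤ 8 * t := by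
    intro j hj
    rcases lt_or_gt_of_ne (ne_of_mem_erase hj) with h | h
    · exact hrow j h
    · rw [gsT_eq_zero_of_lt f h, norm_zero]; positivity
  calc ∑ j ∈ univ.erase i, ‖gsT f i j‖ ≤ ∑ _j ∈ univ.erase i, 8 * t := Finset.sum_le_sum hterm
    _ = (univ.erase i).card * (8 * t) := by rw [Finset.sum_const, nsmul_eq_mul]
    _ ≤ n * (8 * t) := by
        apply mul_le_mul_of_nonneg_right _ (by positivity)
        exact_mod_cast (card_le_univ _).trans (by simp)
    _ = 8 * t * n := by ring

/-- **Off-diagonal inner products with a Gram–Schmidt vector are small**: for `i < k`,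
`|⟪b*ᵢ, bₖ⟫| ≤ t N (1 + 8 t n) ≤ 2 t N` (given the row bound on `T i ·` and `8 t n ≤ 1`).
[folklore] -/
theorem norm_inner_gramSchmidt_le (hG : NearOrthogonal f N t) (hN : 0 ≤ N) (ht0 : 0 ≤ t)
    (htn : 8 * t * n ≤ 1) {i k : Fin n} (hik : i < k) (hrow : ∀ j, j < i → ‖gsT f i j‖ ≤ 8 * t) :
    ‖⟪gramSchmidt ℂ f i, f k⟫‖ ≤ 2 * t * N := by
  rw [inner_gramSchmidt_eq_sum]
  have hterm : ∀ j, ‖(starRingEnd ℂ) (gsT f i j) * ⟪f j, f k⟫‖ ≤ ‖gsT f i j‖ * (t * N) := by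
    intro j
    rw [norm_mul, RCLike.norm_conj]
    by_cases hjk : j = k
    · subst hjk
      rw [gsT_eq_zero_of_lt f hik, norm_zero, zero_mul, zero_mul]
    · refine mul_le_mul_of_nonneg_left ?_ (norm_nonneg _)
      simpa [if_neg hjk] using hG j k
  calc ‖∑ j, (starRingEnd ℂ) (gsT f i j) * ⟪f j, f k⟫‖
      ≤ ∑ j, ‖(starRingEnd ℂ) (gsT f i j) * ⟪f j, f k⟫‖ := norm_sum_le _ _
    _ ≤ ∑ j, ‖gsT f i j‖ * (t * N) := Finset.sum_le_sum fun j _ => hterm j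
    _ = (∑ j, ‖gsT f i j‖) * (t * N) := by rw [Finset.sum_mul]
    _ ≤ (1 + 8 * t * n) * (t * N) :=
        mul_le_mul_of_nonneg_right (sum_norm_gsT_le hrow ht0) (by positivity)
    _ ≤ 2 * (t * N) := by
        apply mul_le_mul_of_nonneg_right _ (by positivity)
        linarith
    _ = 2 * t * N := by ring

/-- **Gram–Schmidt vectors keep their length**: `N/2 ≤ ‖b*ᵢ‖²` (given the row bound on `T i ·`,
`8 t n ≤ 1` and `t ≤ 1/4`): `‖b*ᵢ‖² = ⟪b*ᵢ, bᵢ⟫ = ⟪bᵢ, bᵢ⟫ + ∑_{j<i} conj(T i j) ⟪bⱼ, bᵢ⟫`.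
[folklore] -/
theorem half_le_norm_gramSchmidt_sq (hG : NearOrthogonal f N t) (hN : 0 ≤ N) (ht0 : 0 ≤ t)
    (htn : 8 * t * n ≤ 1) (ht4 : t ≤ 1 / 4) {i : Fin n}
    (hrow : ∀ j, j < i → ‖gsT f i j‖ ≤ 8 * t) :
    N / 2 ≤ ‖gramSchmidt ℂ f i‖ ^ 2 := by
  have hsq : (‖gramSchmidt ℂ f i‖ ^ 2 : ℝ) = (⟪gramSchmidt ℂ f i, f i⟫).re :=
    norm_gramSchmidt_sq_eq_re f i
  -- split off the diagonal term
  have hsplit : ⟪gramSchmidt ℂ f i, f i⟫ =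
      ⟪f i, f i⟫ + ∑ j ∈ univ.erase i, (starRingEnd ℂ) (gsT f i j) * ⟪f j, f i⟫ := by
    rw [inner_gramSchmidt_eq_sum, ← Finset.add_sum_erase _ _ (mem_univ i), gsT_self, map_one,
      one_mul]
  have hrest : ‖∑ j ∈ univ.erase i, (starRingEnd ℂ) (gsT f i j) * ⟪f j, f i⟫‖ ≤ t * N := by
    have hterm : ∀ j ∈ univ.erase i,
        ‖(starRingEnd ℂ) (gsT f i j) * ⟪f j, f i⟫‖ ≤ 8 * t * (t * N) := by
      intro j hj
      rw [norm_mul, RCLike.norm_conj]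
      have hji : j ≠ i := ne_of_mem_erase hj
      have h1 : ‖gsT f i j‖ ≤ 8 * t := by
        rcases lt_or_gt_of_ne hji with h | h
        · exact hrow j h
        · rw [gsT_eq_zero_of_lt f h, norm_zero]; positivity
      have h2 : ‖⟪f j, f i⟫‖ ≤ t * N := by simpa [if_neg hji] using hG j i
      exact mul_le_mul h1 h2 (norm_nonneg _) (by positivity)
    calc _ ≤ ∑ j ∈ univ.erase i, ‖(starRingEnd ℂ) (gsT f i j) * ⟪f j, f i⟫‖ := norm_sum_le _ _
      _ ≤ ∑ _j ∈ univ.erase i, 8 * t * (t * N) := Finset.sum_le_sum hterm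
      _ = (univ.erase i).card * (8 * t * (t * N)) := by rw [Finset.sum_const, nsmul_eq_mul]
      _ ≤ n * (8 * t * (t * N)) := by
          apply mul_le_mul_of_nonneg_right _ (by positivity)
          exact_mod_cast (card_le_univ _).trans (by simp)
      _ = (8 * t * n) * (t * N) := by ring
      _ ≤ 1 * (t * N) := mul_le_mul_of_nonneg_right htn (by positivity)
      _ = t * N := one_mul _
  have hdiag : N - t * N ≤ (⟪f i, f i⟫).re := by
    have h := hG i i
    rw [if_pos rfl] at h
    have := Complex.abs_re_le_norm (⟪f i, f i⟫ - (N : ℂ))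
    rw [Complex.sub_re, Complex.ofReal_re] at this
    have := (abs_le.1 (this.trans h)).1
    linarith
  have hre : (⟪f i, f i⟫).re - t * N ≤ (⟪gramSchmidt ℂ f i, f i⟫).re := by
    rw [hsplit, Complex.add_re]
    have := Complex.abs_re_le_norm (∑ j ∈ univ.erase i, (starRingEnd ℂ) (gsT f i j) * ⟪f j, f i⟫)
    have := (abs_le.1 (this.trans hrest)).1
    linarith
  rw [hsq]
  nlinarith

/-- **Gram–Schmidt does not lengthen**: `‖b*ᵢ‖² ≤ (1 + t) N` (no hypothesis on `T`). [folklore] -/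
theorem norm_gramSchmidt_sq_le (hG : NearOrthogonal f N t) (hN : 0 ≤ N) (i : Fin n) :
    ‖gramSchmidt ℂ f i‖ ^ 2 ≤ (1 + t) * N := by
  have hfi : ‖f i‖ ^ 2 ≤ (1 + t) * N := by
    have h := hG i i
    rw [if_pos rfl] at h
    have h1 : ‖f i‖ ^ 2 ≤ ‖⟪f i, f i⟫‖ := by
      rw [norm_sq_eq_re_inner (𝕜 := ℂ)]
      exact Complex.re_le_norm _
    have h2 : ‖⟪f i, f i⟫‖ - ‖(N : ℂ)‖ ≤ t * N := (norm_sub_norm_le _ _).trans h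
    rw [Complex.norm_real, Real.norm_eq_abs, abs_of_nonneg hN] at h2
    linarith
  have hle : ‖gramSchmidt ℂ f i‖ ≤ ‖f i‖ := by
    have h1 : ‖gramSchmidt ℂ f i‖ ^ 2 ≤ ‖gramSchmidt ℂ f i‖ * ‖f i‖ := by
      rw [norm_gramSchmidt_sq_eq_re]
      exact (Complex.re_le_norm _).trans (norm_inner_le_norm (𝕜 := ℂ) _ _)
    by_cases h0 : ‖gramSchmidt ℂ f i‖ = 0
    · rw [h0]; exact norm_nonneg _
    · have hpos : 0 < ‖gramSchmidt ℂ f i‖ := lt_of_le_of_ne (norm_nonneg _) (Ne.symm h0)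
      rw [sq] at h1
      exact le_of_mul_le_mul_left h1 hpos
  calc ‖gramSchmidt ℂ f i‖ ^ 2 ≤ ‖f i‖ ^ 2 := pow_le_pow_left₀ (norm_nonneg _) hle 2
    _ ≤ (1 + t) * N := hfi

/-- **The projection coefficients are small**: `|c i k| ≤ 4t` for `i < k` (given the row bound
on `T i ·`). [folklore] -/
theorem norm_gsCoeff_le (hG : NearOrthogonal f N t) (hN : 0 < N) (ht0 : 0 ≤ t)
    (htn : 8 * t * n ≤ 1) (ht4 : t ≤ 1 / 4) {i k : Fin n} (hik : i < k)
    (hrow : ∀ j, j < i → ‖gsT f i j‖ ≤ 8 * t) :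
    ‖gsCoeff f i k‖ ≤ 4 * t := by
  have hnum := norm_inner_gramSchmidt_le hG hN.le ht0 htn hik hrow
  have hden := half_le_norm_gramSchmidt_sq hG hN.le ht0 htn ht4 hrow
  have hden_pos : 0 < ‖gramSchmidt ℂ f i‖ ^ 2 := lt_of_lt_of_le (by positivity) hden
  rw [gsCoeff, norm_div, norm_pow, Complex.norm_real, Real.norm_eq_abs, abs_norm,
    div_le_iff₀ hden_pos]
  calc ‖⟪gramSchmidt ℂ f i, f k⟫‖ ≤ 2 * t * N := hnum
    _ = 4 * t * (N / 2) := by ring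
    _ ≤ 4 * t * ‖gramSchmidt ℂ f i‖ ^ 2 := mul_le_mul_of_nonneg_left hden (by positivity)

/-- **Main perturbation bound.** For a nearly orthogonal family (`|⟪bᵢ, bⱼ⟫ - N δᵢⱼ| ≤ t N`,
`N > 0`, `0 ≤ t ≤ 1/4`, `8 t n ≤ 1`) the inverse triangular factor is close to the identity:
`|T k j| ≤ 8 t` for all `j < k`. Strong induction on `k`:
`T k j = -∑_{i<k} c i k · T i j` with `|c i k| ≤ 4t`, the term `i = j` contributing `4t` and the
`≤ n` others `4t · 8t` each. [folklore] -/
theorem norm_gsT_le (hG : NearOrthogonal f N t) (hN : 0 < N) (ht0 : 0 ≤ t)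
    (htn : 8 * t * n ≤ 1) (ht4 : t ≤ 1 / 4) :
    ∀ k j : Fin n, j < k → ‖gsT f k j‖ ≤ 8 * t := by
  intro k
  induction k using WellFoundedLT.induction with
  | ind k ih =>
    intro j hjk
    rw [gsT_def, if_neg hjk.ne, zero_sub, norm_neg]
    have hterm : ∀ i ∈ Iio k, ‖gsCoeff f i k * gsT f i j‖ ≤
        4 * t * (if i = j then 1 else 8 * t) := by
      intro i hi
      have hik : i < k := mem_Iio.1 hi
      rw [norm_mul]
      refine mul_le_mul (norm_gsCoeff_le hG hN ht0 htn ht4 hik (ih i hik)) ?_ (norm_nonneg _)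
        (by positivity)
      split_ifs with hij
      · rw [hij, gsT_self, norm_one]
      · rcases lt_or_gt_of_ne hij with h | h
        · rw [gsT_eq_zero_of_lt f h, norm_zero]; positivity
        · exact ih i hik j h
    have hcount : ∑ i ∈ Iio k, (4 * t * (if i = j then (1 : ℝ) else 8 * t)) ≤
        4 * t * (1 + 8 * t * n) := by
      rw [← Finset.mul_sum]
      refine mul_le_mul_of_nonneg_left ?_ (by positivity)
      calc ∑ i ∈ Iio k, (if i = j then (1 : ℝ) else 8 * t)
          ≤ ∑ i, (if i = j then (1 : ℝ) else 8 * t) :=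
            Finset.sum_le_sum_of_subset_of_nonneg (subset_univ _) fun i _ _ => by
              split_ifs <;> positivity
        _ = 1 + ∑ _i ∈ univ.erase j, 8 * t := by
            rw [← Finset.add_sum_erase _ _ (mem_univ j), if_pos rfl,
              Finset.sum_congr rfl fun i hi => if_neg (ne_of_mem_erase hi)]
        _ ≤ 1 + 8 * t * n := by
            rw [Finset.sum_const, nsmul_eq_mul]
            have : ((univ.erase j).card : ℝ) ≤ n := by
              exact_mod_cast (card_le_univ _).trans (by simp)
            nlinarith
    calc ‖∑ i ∈ Iio k, gsCoeff f i k * gsT f i j‖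
        ≤ ∑ i ∈ Iio k, ‖gsCoeff f i k * gsT f i j‖ := norm_sum_le _ _
      _ ≤ ∑ i ∈ Iio k, 4 * t * (if i = j then (1 : ℝ) else 8 * t) := Finset.sum_le_sum hterm
      _ ≤ 4 * t * (1 + 8 * t * n) := hcount
      _ ≤ 4 * t * 2 := by apply mul_le_mul_of_nonneg_left _ (by positivity); linarith
      _ = 8 * t := by ring

/-- Corollary: `N/2 ≤ ‖b*ₖ‖²` for every `k`. [folklore] -/
theorem half_le_norm_gramSchmidt_sq' (hG : NearOrthogonal f N t) (hN : 0 < N) (ht0 : 0 ≤ t)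
    (htn : 8 * t * n ≤ 1) (ht4 : t ≤ 1 / 4) (k : Fin n) :
    N / 2 ≤ ‖gramSchmidt ℂ f k‖ ^ 2 :=
  half_le_norm_gramSchmidt_sq hG hN.le ht0 htn ht4 (norm_gsT_le hG hN ht0 htn ht4 k)

/-- Corollary: the Gram–Schmidt vectors are nonzero. [folklore] -/
theorem gramSchmidt_ne_zero_of_nearOrthogonal (hG : NearOrthogonal f N t) (hN : 0 < N)
    (ht0 : 0 ≤ t) (htn : 8 * t * n ≤ 1) (ht4 : t ≤ 1 / 4) (k : Fin n) :
    gramSchmidt ℂ f k ≠ 0 := by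
  intro h
  have := half_le_norm_gramSchmidt_sq' hG hN ht0 htn ht4 k
  rw [h, norm_zero] at this
  norm_num at this
  linarith

end General

/-! ### Matrices: Gram–Schmidt on the columns, the factorisation `U = B · T · D^{-1/2}` -/

section Matrices

variable {m n : ℕ}

local notation "⟪" x ", " y "⟫" => inner ℂ x y

/-- Column `k` of `B` as a vector of `ℂᵐ` (Euclidean inner product). [folklore] -/
noncomputable def colVec (B : _root_.Matrix (Fin m) (Fin n) ℂ) (k : Fin n) :
    EuclideanSpace ℂ (Fin m) :=
  WithLp.toLp 2 fun r => B r k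

/-- Coordinates of a column vector. [folklore] -/
@[simp] theorem colVec_apply (B : _root_.Matrix (Fin m) (Fin n) ℂ) (k : Fin n) (r : Fin m) :
    colVec B k r = B r k := rfl

/-- The Gram matrix of the columns is `Bᴴ B`. [folklore] -/
theorem inner_colVec (B : _root_.Matrix (Fin m) (Fin n) ℂ) (i j : Fin n) :
    ⟪colVec B i, colVec B j⟫ = (Bᴴ * B) i j := by
  rw [PiLp.inner_apply, Matrix.mul_apply]
  refine Finset.sum_congr rfl fun r _ => ?_
  rw [colVec_apply, colVec_apply, Matrix.conjTranspose_apply, RCLike.inner_apply, mul_comm]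
  rfl

/-- The matrix `B*` whose columns are the Gram–Schmidt vectors of the columns of `B`. [folklore] -/
noncomputable def gsMatrix (B : _root_.Matrix (Fin m) (Fin n) ℂ) : _root_.Matrix (Fin m) (Fin n) ℂ :=
  Matrix.of fun r k => gramSchmidt ℂ (colVec B) k r

/-- The unit upper triangular factor `T` with `B* = B · T` (`T j k = gsT (colVec B) k j`).
[folklore] -/
noncomputable def tMatrix (B : _root_.Matrix (Fin m) (Fin n) ℂ) : _root_.Matrix (Fin n) (Fin n) ℂ :=
  Matrix.of fun j k => gsT (colVec B) k j

/-- The column-normalised Gram–Schmidt matrix `U = B* · diag(‖b*ₖ‖⁻¹)` (junk column `0` where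
`b*ₖ = 0`). [folklore] -/
noncomputable def gsUnit (B : _root_.Matrix (Fin m) (Fin n) ℂ) : _root_.Matrix (Fin m) (Fin n) ℂ :=
  Matrix.of fun r k => gsMatrix B r k / (‖gramSchmidt ℂ (colVec B) k‖ : ℂ)

/-- **`B* = B · T`.** [folklore] -/
theorem gsMatrix_eq_mul (B : _root_.Matrix (Fin m) (Fin n) ℂ) : gsMatrix B = B * tMatrix B := by
  ext r k
  simp only [gsMatrix, tMatrix, Matrix.of_apply, Matrix.mul_apply]
  rw [gramSchmidt_eq_sum_gsT]
  rw [WithLp.ofLp_sum, Finset.sum_apply]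
  refine Finset.sum_congr rfl fun j _ => ?_
  rw [WithLp.ofLp_smul, Pi.smul_apply, smul_eq_mul, mul_comm]
  rfl

/-- `T` is unit upper triangular: zero below the diagonal. [folklore] -/
theorem tMatrix_apply_of_lt (B : _root_.Matrix (Fin m) (Fin n) ℂ) {j k : Fin n} (h : k < j) :
    tMatrix B j k = 0 :=
  gsT_eq_zero_of_lt _ h

/-- `T` is unit upper triangular: ones on the diagonal. [folklore] -/
theorem tMatrix_apply_self (B : _root_.Matrix (Fin m) (Fin n) ℂ) (k : Fin n) : tMatrix B k k = 1 :=
  gsT_self _ k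

/-- `T - 1` is strictly upper triangular. [folklore] -/
theorem tMatrix_sub_one_apply_eq_zero (B : _root_.Matrix (Fin m) (Fin n) ℂ) {j k : Fin n}
    (h : k ≤ j) : (tMatrix B - 1) j k = 0 := by
  rw [Matrix.sub_apply]
  rcases h.lt_or_eq with h | h
  · rw [tMatrix_apply_of_lt B h, Matrix.one_apply_ne (ne_of_gt h), sub_zero]
  · rw [h, tMatrix_apply_self, Matrix.one_apply_eq, sub_self]

/-- `U = B* · diag(‖b*ₖ‖⁻¹)`. [folklore] -/
theorem gsUnit_eq_mul_diagonal (B : _root_.Matrix (Fin m) (Fin n) ℂ) :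
    gsUnit B = gsMatrix B * Matrix.diagonal fun k => ((‖gramSchmidt ℂ (colVec B) k‖ : ℂ))⁻¹ := by
  ext r k
  simp [gsUnit, Matrix.mul_diagonal, div_eq_mul_inv]

/-- The entries of `Uᴴ U` are the normalised inner products of the Gram–Schmidt vectors.
[folklore] -/
theorem conjTranspose_mul_gsUnit_apply (B : _root_.Matrix (Fin m) (Fin n) ℂ) (i k : Fin n) :
    ((gsUnit B)ᴴ * gsUnit B) i k =
      ⟪gramSchmidt ℂ (colVec B) i, gramSchmidt ℂ (colVec B) k⟫ /
        ((‖gramSchmidt ℂ (colVec B) i‖ : ℂ) * (‖gramSchmidt ℂ (colVec B) k‖ : ℂ)) := by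
  rw [Matrix.mul_apply, PiLp.inner_apply, Finset.sum_div]
  refine Finset.sum_congr rfl fun r _ => ?_
  simp only [Matrix.conjTranspose_apply, gsUnit, gsMatrix, Matrix.of_apply, RCLike.inner_apply,
    star_div₀, Complex.star_def, Complex.conj_ofReal]
  rw [div_mul_div_comm, mul_comm ((starRingEnd ℂ) _)]

/-- **`U` is column-orthonormal** (`Uᴴ U = 1`) as soon as no Gram–Schmidt vector vanishes.
[folklore] -/
theorem conjTranspose_mul_gsUnit (B : _root_.Matrix (Fin m) (Fin n) ℂ)
    (h : ∀ k, gramSchmidt ℂ (colVec B) k ≠ 0) : (gsUnit B)ᴴ * gsUnit B = 1 := by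
  ext i k
  rw [conjTranspose_mul_gsUnit_apply]
  by_cases hik : i = k
  · subst hik
    have hself : ⟪gramSchmidt ℂ (colVec B) i, gramSchmidt ℂ (colVec B) i⟫ =
        ((‖gramSchmidt ℂ (colVec B) i‖ : ℂ)) ^ 2 := inner_self_eq_norm_sq_to_K (𝕜 := ℂ) _
    have hne : ((‖gramSchmidt ℂ (colVec B) i‖ : ℂ)) ≠ 0 := by
      rw [Ne, Complex.ofReal_eq_zero, norm_eq_zero]
      exact h i
    rw [Matrix.one_apply_eq, hself, sq, div_self (mul_ne_zero hne hne)]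
  · rw [Matrix.one_apply_ne hik, gramSchmidt_orthogonal ℂ _ hik, zero_div]

/-- The permanent is homogeneous in each column: `Per(M · diag d) = Per(M) · ∏ d`. [folklore] -/
theorem permanent_mul_diagonal {ι : Type*} [Fintype ι] [DecidableEq ι] {R : Type*} [CommRing R]
    (M : _root_.Matrix ι ι R) (d : ι → R) :
    (M * Matrix.diagonal d).permanent = M.permanent * ∏ i, d i := by
  simp only [Matrix.permanent, Matrix.mul_diagonal, Finset.prod_mul_distrib, Finset.sum_mul]

/-- **Rows of `U` factor through `T`**: for every row selection `S`,
`U_S = B_S · T · diag(‖b*ₖ‖⁻¹)`, hence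
`Per(U_S) = Per(B_S · T) · ∏ₖ ‖b*ₖ‖⁻¹`. [folklore] -/
theorem permanent_submatrix_gsUnit (B : _root_.Matrix (Fin m) (Fin n) ℂ) (S : Fin n → Fin m) :
    ((gsUnit B).submatrix S id).permanent =
      (B.submatrix S id * tMatrix B).permanent * ∏ k, ((‖gramSchmidt ℂ (colVec B) k‖ : ℂ))⁻¹ := by
  rw [← permanent_mul_diagonal]
  congr 1
  rw [gsUnit_eq_mul_diagonal, gsMatrix_eq_mul]
  rfl

/-! ### The structure theorem under near-orthogonality of the columns -/

variable {B : _root_.Matrix (Fin m) (Fin n) ℂ} {N t : ℝ}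

/-- Near-orthogonality of the columns in terms of the Gram matrix `Bᴴ B`. [folklore] -/
theorem nearOrthogonal_colVec
    (hG : ∀ i j, ‖(Bᴴ * B) i j - (if i = j then (N : ℂ) else 0)‖ ≤ t * N) :
    NearOrthogonal (colVec B) N t := fun i j => by
  rw [inner_colVec]; exact hG i j

/-- **Structure theorem, (i)**: `T - 1` is strictly upper triangular with entries `≤ 8t`.
[folklore] -/
theorem norm_tMatrix_sub_one_le
    (hG : ∀ i j, ‖(Bᴴ * B) i j - (if i = j then (N : ℂ) else 0)‖ ≤ t * N)
    (hN : 0 < N) (ht0 : 0 ≤ t) (htn : 8 * t * n ≤ 1) (ht4 : t ≤ 1 / 4) (j k : Fin n) :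
    ‖(tMatrix B - 1) j k‖ ≤ 8 * t := by
  rcases le_or_gt k j with h | h
  · rw [tMatrix_sub_one_apply_eq_zero B h, norm_zero]; positivity
  · rw [Matrix.sub_apply, Matrix.one_apply_ne (ne_of_lt h), sub_zero]
    exact norm_gsT_le (nearOrthogonal_colVec hG) hN ht0 htn ht4 k j h

/-- **Structure theorem, (ii)**: `N/2 ≤ ‖b*ₖ‖² ≤ (1+t) N`; in particular `U` is
column-orthonormal. [folklore] -/
theorem norm_gramSchmidt_colVec_sq_bounds
    (hG : ∀ i j, ‖(Bᴴ * B) i j - (if i = j then (N : ℂ) else 0)‖ ≤ t * N)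
    (hN : 0 < N) (ht0 : 0 ≤ t) (htn : 8 * t * n ≤ 1) (ht4 : t ≤ 1 / 4) (k : Fin n) :
    N / 2 ≤ ‖gramSchmidt ℂ (colVec B) k‖ ^ 2 ∧ ‖gramSchmidt ℂ (colVec B) k‖ ^ 2 ≤ (1 + t) * N :=
  ⟨half_le_norm_gramSchmidt_sq' (nearOrthogonal_colVec hG) hN ht0 htn ht4 k,
    norm_gramSchmidt_sq_le (nearOrthogonal_colVec hG) hN.le k⟩

/-- **Structure theorem, (iii)**: `Uᴴ U = 1`. [folklore] -/
theorem conjTranspose_mul_gsUnit_of_nearOrthogonal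
    (hG : ∀ i j, ‖(Bᴴ * B) i j - (if i = j then (N : ℂ) else 0)‖ ≤ t * N)
    (hN : 0 < N) (ht0 : 0 ≤ t) (htn : 8 * t * n ≤ 1) (ht4 : t ≤ 1 / 4) :
    (gsUnit B)ᴴ * gsUnit B = 1 :=
  conjTranspose_mul_gsUnit B
    (gramSchmidt_ne_zero_of_nearOrthogonal (nearOrthogonal_colVec hG) hN ht0 htn ht4)

end Matrices

end Literature.Analysis.Matrix
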